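import Summits.QuantumFields.YangMills.Theorems.FlatTubeReductionRecordRateBricksPot
import Summits.QuantumFields.YangMills.Theorems.LuscherReductionTwistedTraceScalingRecordInequalities
import HarnessLib

/-!
# The slow window of «ratepack-v3» at the core exponent `s = 1/6`: `δ₁ = D·recordDelta1 L (1/6) = 14D·β^{-1/6}/|Site|` — the four real-analysis fields of the hand-off object
# `RecordBORatePotInput` DISCHARGED for this canonical choice, and K1 from the ANALYTIC input alone
# (route `FlatTubeReduction`, crux K1 `NearFlatRatioLaw` stmt-QuantumFields-24720; seat `ym-line-ftr-p1` g12; R2b1 RECORD rung — no summit statement is proved here)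

At `s = 1/6` the record radius `recordDelta1 L s = 14β^{-s}/|Site|` (lane A) is too small to contain the one-site near-top quasimode for `L ≥ 3` (`√λ_b(L³β) = (2/(L³β))^{1/6}`;
g10/g11's window caveat, `sqrt_bareLambda_le_recordDelta1` needs `s < 1/6`).  Since the fat factors `K, M` of the record weight may depend on `L` (`nearFlatRatioLaw_of_recordRatePotInput`),
the fix is a SCALED window `δ₁ = D·recordDelta1 L (1/6)` with `D ≥ max 1 (|Site|/7)` and `K = 42D + 1`:
* `sq_scaledDelta1_eq` — `δ₁² = c_{L,D}·λ_b(L³β)` EXACTLY for `β ≥ 1` (`c = (14D/|Site|)²·L/2^{1/3}`): the window is a rate CORE with equality, so `κ_Wδ₁² ≤ Aλ_b` and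
  `(4κ_b/θ₀)δ₁² ≤ Aλ_b` hold with `A = (κ_W + 4κ_b/θ₀)·c` (`scaledDelta1_window`);
* `sqrt_bareLambda_le_scaledDelta1` (`√λ_b(L³β) ≤ 2β^{-1/6} ≤ δ₁` once `7D ≥ |Site|`), `radii_scaledDelta1` (`|Edge|(4r + δ₁) < (42D+1)β^{-1/6}` once `12|Site|r < β^{-1/6}`),
  `shadow_scaledDelta1` (lane A's `recordChi_shadow`, `D ≥ 1`);
* `AnalyticRatePotInput L D M` — the hand-off object MINUS those four fields (profile, physical two-sided dressed weight, rates, (B-N), (B-T)-rate, (B-ST), (B-OD)-potential on the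
  window `{orbitDist < D·recordDelta1 L (1/6) β}`), ★★★ `AnalyticRatePotInput.toRecord : … → RecordBORatePotInput L (1/6) (42D+1) M`, and
  ★★★★ `nearFlatRatioLaw_of_analyticRatePotInput` — K1 ⟸ ∀ L ≥ 2, one `AnalyticRatePotInput L (D L) (M L)` (`D L ≥ max 1 (|Site 3 L|/7)`, `M L ≥ 2`) + lane A's SHELL.
HONEST FRAMING: real-analysis bookkeeping; the analytic input is OPEN fixed-lattice semiclassics; femto rung R2b1 (RECORD label); not infinite volume, not a gap, not Clay.
One `structure`, one instance `def`, no named facts, no `sorry`.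
-/

set_option autoImplicit false

noncomputable section

open MeasureTheory Filter Topology Real
open scoped BigOperators
open Literature.MathematicalPhysics.QuantumFieldTheory
open Literature.MathematicalPhysics.QuantumLattice

namespace Summit.QuantumFields.YangMills.Theorems.FemtoTransferGap.RateTube

open Summit.QuantumFields.YangMills.Theorems.FemtoTransferGap
open Summit.QuantumFields.YangMills.Theorems.FemtoTransferGap.TwoLattice.Avg
open Summit.QuantumFields.YangMills.Theorems.FemtoTransferGap.TwoLattice.ConstTube
open Summit.QuantumFields.YangMills.Theorems.FemtoTransferGap.TwoLattice.Stiff (LinkSpace)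
open Summit.QuantumFields.YangMills.Theorems.FemtoCutoffLadder

variable {L : ℕ} [NeZero L]

/-! ## §1 The scaled window at `s = 1/6` -/

/-- ★ **The window is a rate core, with equality**: for `β ≥ 1`, `(D·recordDelta1 L (1/6) β)² = ((14D/|Site|)²·L/2^{1/3})·λ_b(L³β)`. [folklore] -/
theorem sq_scaledDelta1_eq (D : ℝ) {β : ℝ} (hβ : 1 ≤ β) :
    (D * recordDelta1 L (1 / 6) β) ^ 2 = ((14 * D / Fintype.card (Site 3 L)) ^ 2 * L / (2 : ℝ) ^ ((1 : ℝ) / 3)) * bareLambda ((L : ℝ) ^ 3 * β) := by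
  have hβ0 : 0 < β := by linarith
  have hN := card_site_pos (L := L)
  have hL0 : (0 : ℝ) < L := by exact_mod_cast Nat.pos_of_ne_zero (NeZero.ne L)
  have h2 : (0 : ℝ) < (2 : ℝ) ^ ((1 : ℝ) / 3) := Real.rpow_pos_of_pos two_pos _
  unfold recordDelta1
  rw [powScale_eq hβ, bareLambda_cube_mul hβ0 L, bareLambda_eq_rpow hβ0]
  -- `(β^{-1/6})² = β^{-1/3}`
  have hsq : (β ^ (-(1 / 6 : ℝ))) ^ 2 = β ^ (-(1 : ℝ) / 3) := by
    rw [← Real.rpow_natCast, ← Real.rpow_mul hβ0.le]; norm_num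
  have e1 : (D * (14 * β ^ (-(1 / 6 : ℝ)) / Fintype.card (Site 3 L))) ^ 2 = (14 * D / Fintype.card (Site 3 L)) ^ 2 * (β ^ (-(1 / 6 : ℝ))) ^ 2 := by
    ring
  rw [e1, hsq]
  field_simp

/-- ★ `√λ_b(L³β) ≤ D·recordDelta1 L (1/6) β` eventually, once `|Site| ≤ 7D` (`√λ_b(B) ≤ (2/β)^{1/6} ≤ 2β^{-1/6}`). [folklore] -/
theorem sqrt_bareLambda_le_scaledDelta1 {D : ℝ} (hD : (Fintype.card (Site 3 L) : ℝ) ≤ 7 * D) :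
    ∀ᶠ β : ℝ in atTop, Real.sqrt (bareLambda ((L : ℝ) ^ 3 * β)) ≤ D * recordDelta1 L (1 / 6) β := by
  have hN := card_site_pos (L := L)
  have hL3 : (1 : ℝ) ≤ (L : ℝ) ^ 3 := one_le_pow₀ (by exact_mod_cast NeZero.one_le)
  filter_upwards [Filter.eventually_ge_atTop (1 : ℝ)] with β hβ1
  have hβ0 : 0 < β := by linarith
  have h1 : bareLambda ((L : ℝ) ^ 3 * β) ≤ bareLambda β := by
    unfold bareLambda
    exact Real.rpow_le_rpow (by positivity) (div_le_div_of_nonneg_left (by norm_num) hβ0 (by nlinarith)) (by norm_num)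
  have h2 : Real.sqrt (bareLambda β) = (2 / β) ^ ((1 : ℝ) / 6) := by
    unfold bareLambda
    rw [Real.sqrt_eq_rpow, ← Real.rpow_mul (by positivity)]; norm_num
  have h3 : (2 / β) ^ ((1 : ℝ) / 6) ≤ 2 * β ^ (-((1 : ℝ) / 6)) := by
    rw [Real.div_rpow (by norm_num) hβ0.le, Real.rpow_neg hβ0.le, div_eq_mul_inv]
    refine mul_le_mul_of_nonneg_right ?_ (by positivity)
    calc (2 : ℝ) ^ ((1 : ℝ) / 6) ≤ (2 : ℝ) ^ (1 : ℝ) := Real.rpow_le_rpow_of_exponent_le (by norm_num) (by norm_num)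
      _ = 2 := Real.rpow_one 2
  have hβs : 0 < β ^ (-((1 : ℝ) / 6)) := Real.rpow_pos_of_pos hβ0 _
  have h4 : 2 * β ^ (-((1 : ℝ) / 6)) ≤ D * (14 * β ^ (-((1 : ℝ) / 6)) / Fintype.card (Site 3 L)) := by
    rw [mul_div_assoc', le_div_iff₀ hN]
    nlinarith [hβs, hD]
  unfold recordDelta1
  rw [powScale_eq hβ1]
  have e : -(1 / 6 : ℝ) = -((1 : ℝ) / 6) := by ring
  rw [e]
  calc Real.sqrt (bareLambda ((L : ℝ) ^ 3 * β)) ≤ Real.sqrt (bareLambda β) := Real.sqrt_le_sqrt h1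
    _ = (2 / β) ^ ((1 : ℝ) / 6) := h2
    _ ≤ 2 * β ^ (-((1 : ℝ) / 6)) := h3
    _ ≤ D * (14 * β ^ (-((1 : ℝ) / 6)) / Fintype.card (Site 3 L)) := h4

/-- ★ **The window inequalities of the hand-off object** for `δ₁ = D·recordDelta1 L (1/6)` (`D > 0`): eventually `0 < δ₁ ≤ 1/2`, `κ_Wδ₁² ≤ Aλ_b(L³β)` and `(4κ_b/θ₀)δ₁² ≤ Aλ_b(L³β)`
with `A = (κ_W + 4κ_b/θ₀)·(14D/|Site|)²·L/2^{1/3}`. [folklore] -/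
theorem scaledDelta1_window {D κW κb θ₀ : ℝ} (hD : 0 < D) (hκW : 0 ≤ κW) (hκb : 0 ≤ κb) (hθ₀ : 0 < θ₀) :
    ∃ β1 : ℝ, ∀ β : ℝ, β1 ≤ β → 0 < D * recordDelta1 L (1 / 6) β ∧ D * recordDelta1 L (1 / 6) β ≤ 1 / 2 ∧
      κW * (D * recordDelta1 L (1 / 6) β) ^ 2 ≤ ((κW + 4 * κb / θ₀) * ((14 * D / Fintype.card (Site 3 L)) ^ 2 * L / (2 : ℝ) ^ ((1 : ℝ) / 3))) * bareLambda ((L : ℝ) ^ 3 * β) ∧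
      4 * κb / θ₀ * (D * recordDelta1 L (1 / 6) β) ^ 2 ≤
        ((κW + 4 * κb / θ₀) * ((14 * D / Fintype.card (Site 3 L)) ^ 2 * L / (2 : ℝ) ^ ((1 : ℝ) / 3))) * bareLambda ((L : ℝ) ^ 3 * β) := by
  have hN := card_site_pos (L := L)
  have hL0 : (0 : ℝ) < L := by exact_mod_cast Nat.pos_of_ne_zero (NeZero.ne L)
  have h2 : (0 : ℝ) < (2 : ℝ) ^ ((1 : ℝ) / 3) := Real.rpow_pos_of_pos two_pos _
  have hκE : 0 ≤ 4 * κb / θ₀ := div_nonneg (by linarith) hθ₀.le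
  set c : ℝ := (14 * D / Fintype.card (Site 3 L)) ^ 2 * L / (2 : ℝ) ^ ((1 : ℝ) / 3) with hc
  have hc0 : 0 ≤ c := by rw [hc]; positivity
  -- `δ₁ ≤ 1/2` eventually: `powScale → 0`
  obtain ⟨β2, hβ2⟩ := powScale_eventually_le (p := 1 / 6) (by norm_num) (c := Fintype.card (Site 3 L) / (28 * D)) (by positivity)
  refine ⟨max β2 1, fun β hβ => ?_⟩
  have hβ1 : 1 ≤ β := (le_max_right _ _).trans hβ
  have hβ0 : 0 < β := by linarith
  have hB0 : 0 < (L : ℝ) ^ 3 * β := by positivity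
  have hd0 : 0 < recordDelta1 L (1 / 6) β := by unfold recordDelta1; exact div_pos (by linarith [powScale_pos (1 / 6) β]) hN
  have hsq := sq_scaledDelta1_eq (L := L) D hβ1
  have hlam0 : 0 ≤ bareLambda ((L : ℝ) ^ 3 * β) := (bareLambda_pos' hB0).le
  refine ⟨mul_pos hD hd0, ?_, ?_, ?_⟩
  · have h := hβ2 β ((le_max_left _ _).trans hβ)
    unfold recordDelta1
    have h1 : D * (14 * powScale (1 / 6) β / Fintype.card (Site 3 L)) ≤ D * (14 * (Fintype.card (Site 3 L) / (28 * D)) / Fintype.card (Site 3 L)) :=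
      mul_le_mul_of_nonneg_left (div_le_div_of_nonneg_right (by linarith) hN.le) hD.le
    have e : D * (14 * (Fintype.card (Site 3 L) / (28 * D)) / Fintype.card (Site 3 L)) = 1 / 2 := by
      field_simp; ring
    linarith [h1, e]
  · rw [hsq, ← hc]
    have : κW * (c * bareLambda ((L : ℝ) ^ 3 * β)) ≤ (κW + 4 * κb / θ₀) * (c * bareLambda ((L : ℝ) ^ 3 * β)) :=
      mul_le_mul_of_nonneg_right (by linarith) (mul_nonneg hc0 hlam0)
    linarith [this]
  · rw [hsq, ← hc]
    have : 4 * κb / θ₀ * (c * bareLambda ((L : ℝ) ^ 3 * β)) ≤ (κW + 4 * κb / θ₀) * (c * bareLambda ((L : ℝ) ^ 3 * β)) :=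
      mul_le_mul_of_nonneg_right (by linarith) (mul_nonneg hc0 hlam0)
    linarith [this]

/-- `hradii` with `K = 42D + 1`: `|Edge|·(4 r β + δ₁ β) < (42D+1)·β^{-1/6}` eventually, once `12|Site|·r β < β^{-1/6}` eventually. [folklore] -/
theorem radii_scaledDelta1 (D : ℝ) {r : ℝ → ℝ} (hr : ∀ᶠ β : ℝ in atTop, 12 * Fintype.card (Site 3 L) * r β < powScale (1 / 6) β) :
    ∀ᶠ β : ℝ in atTop, (Fintype.card (Edge 3 L) : ℝ) * (4 * r β + D * recordDelta1 L (1 / 6) β) < (42 * D + 1) * powScale (1 / 6) β := by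
  have hN := card_site_pos (L := L)
  filter_upwards [hr] with β hβ
  unfold recordDelta1
  rw [TwistedTraceScaling.Negative.R36.card_edge_eq]
  have e : 3 * (Fintype.card (Site 3 L) : ℝ) * (4 * r β + D * (14 * powScale (1 / 6) β / Fintype.card (Site 3 L))) =
      12 * Fintype.card (Site 3 L) * r β + 42 * D * powScale (1 / 6) β := by
    field_simp
    ring
  rw [e]
  linarith

/-- `hshadow` for the scaled window (`D ≥ 1`): lane A's `recordChi_shadow` at `s = 1/6`. [folklore] -/
theorem shadow_scaledDelta1 {D K M : ℝ} (hD : 1 ≤ D) (hK : 0 ≤ K) (hM : 0 ≤ M) :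
    ∀ᶠ β : ℝ in atTop, ∀ U : GaugeConfig 3 L SU2, recordChi L (1 / 6) K M β U ≠ 0 → orbitDist U < powScale (1 / 6) β →
      orbitDist (slowMean L U) < D * recordDelta1 L (1 / 6) β := by
  have hN := card_site_pos (L := L)
  filter_upwards [recordChi_shadow (L := L) (s := 1 / 6) (K := K) (M := M) (by norm_num) hK hM] with β hβ U hU hd
  have h := hβ U hU hd
  have hd0 : 0 ≤ recordDelta1 L (1 / 6) β := by unfold recordDelta1; exact div_nonneg (by linarith [powScale_pos (1 / 6) β]) hN.le
  have : recordDelta1 L (1 / 6) β ≤ D * recordDelta1 L (1 / 6) β := by nlinarith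
  unfold recordDelta1 at this ⊢
  exact lt_of_lt_of_le h this

/-! ## §2 ★★★ The ANALYTIC input at `s = 1/6` and the hand-off object from it -/

variable (L) in
/-- **THE ANALYTIC RATE INPUT WITH POTENTIAL** on the scaled window `{orbitDist < D·recordDelta1 L (1/6) β}`: `RecordBORatePotInput L (1/6) (42D+1) M` minus its four real-analysis
fields (`hδ₁win`, `hcoreR`, `hradii`, `hshadow`), which hold for this window; the profile radius must satisfy `12|Site|·r β < β^{-1/6}` eventually.
[cite: Luscher1983, §3] [cite: SjostrandZworski2007, §2] -/
structure AnalyticRatePotInput (D M : ℝ) where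
  Ω : ℝ → GaugeConfig 3 1 SU2 → LinkSpace L → ℝ
  W : ℝ → GaugeConfig 3 1 SU2 → ℝ
  r : ℝ → ℝ
  σ : ℝ → ℝ
  γ : ℝ → ℝ
  κ : ℝ → ℝ
  b : ℝ → ℝ
  θ₀ : ℝ
  κW : ℝ
  κb : ℝ
  CW : ℝ
  hΩm : ∀ β, Measurable (Function.uncurry (Ω β))
  hΩ1 : ∀ β u x, |Ω β u x| ≤ 1
  hΩinv : ∀ β (g : SU2) (u : GaugeConfig 3 1 SU2) (v : LinkSpace L), Ω β (gaugeTransform (fun _ : Site 3 1 => g) u) (adL L g v) = Ω β u v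
  hΩr : ∀ β u x, Ω β u x ≠ 0 → ‖x‖ ≤ r β
  hWphys : ∀ β, IsPhys (W β)
  hW0 : ∀ β u, 0 ≤ W β u
  hWbU : ∀ β u, |W β u| ≤ CW
  hκW : 0 ≤ κW
  hκb : 0 ≤ κb
  hWsq : ∀ β u, orbitDist u < D * recordDelta1 L (1 / 6) β → |W β u ^ 2 - 1| ≤ κW * orbitDist u ^ 2
  hr : ∀ β, 0 ≤ r β ∧ r β ≤ 1 / 2
  hr_small : ∀ᶠ β : ℝ in atTop, 12 * Fintype.card (Site 3 L) * r β < powScale (1 / 6) β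
  hγ : ∀ β, 0 < γ β
  hσ : ∀ β, 0 < σ β
  hκ0 : ∀ β, 0 ≤ κ β
  hκ_small : ∃ a : ℝ, ∀ᶠ β in atTop, κ β ≤ a * bareLambda ((L : ℝ) ^ 3 * β) ^ 2
  hb : ∀ β, 0 ≤ b β
  hb_small : ∃ a : ℝ, ∀ᶠ β in atTop, b β ^ 2 ≤ a * bareLambda ((L : ℝ) ^ 3 * β) ^ 2
  hθ₀ : 0 < θ₀ ∧ θ₀ ≤ 1
  hN : ∀ᶠ β in atTop, ∀ u : GaugeConfig 3 1 SU2, orbitDist u < D * recordDelta1 L (1 / 6) β →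
    |fibreMassAd L (softWeight (recordChi L (1 / 6) (42 * D + 1) M β)) (Ω β) u - γ β| ≤ κ β * γ β
  hT : ∀ᶠ β in atTop, ∀ φ : GaugeConfig 3 1 SU2 → ℝ, Measurable φ → (∃ C : ℝ, ∀ u, |φ u| ≤ C) →
    (∀ (g : Site 3 1 → SU2) (u : GaugeConfig 3 1 SU2), φ (gaugeTransform g u) = φ u) → (∀ u, φ u ≠ 0 → orbitDist u < D * recordDelta1 L (1 / 6) β) →
    |tubeForm β (boFunAd L φ (Ω β)) - σ β * γ β * qform su2Rep ((L : ℝ) ^ 3 * β) (fun u => φ u * W β u) (fun u => φ u * W β u)| ≤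
      κ β * (σ β * γ β) * (qform su2Rep ((L : ℝ) ^ 3 * β) (fun u => φ u * W β u) (fun u => φ u * W β u) + levelValue su2Rep 1 ((L : ℝ) ^ 3 * β) 0 * l2 φ φ)
  hST : ∀ᶠ β in atTop, ∀ v : GaugeConfig 3 L SU2 → ℝ, Measurable v → (∃ C : ℝ, ∀ U, |v U| ≤ C) → (∀ U, v U ≠ 0 → recordChi L (1 / 6) (42 * D + 1) M β U ≠ 0) →
    (∀ u, fibreInnerAd L (softWeight (recordChi L (1 / 6) (42 * D + 1) M β)) (Ω β) v u = 0) →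
    tubeForm β v ≤ (1 - θ₀) * (σ β * levelValue su2Rep 1 ((L : ℝ) ^ 3 * β) 0) * tubeNormSq (softWeight (recordChi L (1 / 6) (42 * D + 1) M β)) v
  hODpot : ∀ᶠ β in atTop, ∀ (φ : GaugeConfig 3 1 SU2 → ℝ) (v : GaugeConfig 3 L SU2 → ℝ), Measurable φ → (∃ C : ℝ, ∀ u, |φ u| ≤ C) →
    (∀ (g : Site 3 1 → SU2) (u : GaugeConfig 3 1 SU2), φ (gaugeTransform g u) = φ u) → (∀ u, φ u ≠ 0 → orbitDist u < D * recordDelta1 L (1 / 6) β) →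
    Measurable v → (∃ C : ℝ, ∀ U, |v U| ≤ C) → (∀ U, v U ≠ 0 → recordChi L (1 / 6) (42 * D + 1) M β U ≠ 0) →
    (∀ u, fibreInnerAd L (softWeight (recordChi L (1 / 6) (42 * D + 1) M β)) (Ω β) v u = 0) →
    |tubeCross β (boFunAd L φ (Ω β)) v| ≤ (σ β * levelValue su2Rep 1 ((L : ℝ) ^ 3 * β) 0) *
        Real.sqrt (b β ^ 2 * tubeNormSq (softWeight (recordChi L (1 / 6) (42 * D + 1) M β)) (boFunAd L φ (Ω β)) +
          κb * γ β * ∫ u, (if orbitDist u < D * recordDelta1 L (1 / 6) β then orbitDist u ^ 2 else 0) * φ u ^ 2 ∂configMeasure SU2 1) *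
        Real.sqrt (tubeNormSq (softWeight (recordChi L (1 / 6) (42 * D + 1) M β)) v) ∧
    |tubeCross β v (boFunAd L φ (Ω β))| ≤ (σ β * levelValue su2Rep 1 ((L : ℝ) ^ 3 * β) 0) *
        Real.sqrt (b β ^ 2 * tubeNormSq (softWeight (recordChi L (1 / 6) (42 * D + 1) M β)) (boFunAd L φ (Ω β)) +
          κb * γ β * ∫ u, (if orbitDist u < D * recordDelta1 L (1 / 6) β then orbitDist u ^ 2 else 0) * φ u ^ 2 ∂configMeasure SU2 1) *
        Real.sqrt (tubeNormSq (softWeight (recordChi L (1 / 6) (42 * D + 1) M β)) v)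

/-- ★★★ **The hand-off object from the analytic input** on the scaled window (`D ≥ max 1 (|Site|/7)`, `M ≥ 0`): the four real-analysis fields by §1. [folklore] -/
def AnalyticRatePotInput.toRecord {D M : ℝ} (hD1 : 1 ≤ D) (hD7 : (Fintype.card (Site 3 L) : ℝ) ≤ 7 * D) (hM : 0 ≤ M) (I : AnalyticRatePotInput L D M) :
    RecordBORatePotInput L (1 / 6) (42 * D + 1) M where
  Ω := I.Ω
  W := I.W
  r := I.r
  δ₁ := fun β => D * recordDelta1 L (1 / 6) β
  σ := I.σ
  γ := I.γ
  κ := I.κ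
  b := I.b
  θ₀ := I.θ₀
  κW := I.κW
  κb := I.κb
  A := (I.κW + 4 * I.κb / I.θ₀) * ((14 * D / Fintype.card (Site 3 L)) ^ 2 * L / (2 : ℝ) ^ ((1 : ℝ) / 3))
  CW := I.CW
  hΩm := I.hΩm
  hΩ1 := I.hΩ1
  hΩinv := I.hΩinv
  hΩr := I.hΩr
  hWphys := I.hWphys
  hW0 := I.hW0
  hWbU := I.hWbU
  hκW := I.hκW
  hκb := I.hκb
  hA := by
    have h2 : (0 : ℝ) < (2 : ℝ) ^ ((1 : ℝ) / 3) := Real.rpow_pos_of_pos two_pos _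
    have hL0 : (0 : ℝ) ≤ L := by positivity
    have := div_nonneg (by linarith [I.hκb] : (0 : ℝ) ≤ 4 * I.κb) I.hθ₀.1.le
    have hk : 0 ≤ I.κW + 4 * I.κb / I.θ₀ := by linarith [I.hκW]
    positivity
  hWsq := I.hWsq
  hδ₁win := scaledDelta1_window (L := L) (by linarith) I.hκW I.hκb I.hθ₀.1
  hr := I.hr
  hγ := I.hγ
  hcoreR := sqrt_bareLambda_le_scaledDelta1 hD7
  hradii := radii_scaledDelta1 D I.hr_small
  hshadow := shadow_scaledDelta1 hD1 (by linarith) hM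
  hσ := I.hσ
  hκ0 := I.hκ0
  hκ_small := I.hκ_small
  hb := I.hb
  hb_small := I.hb_small
  hθ₀ := I.hθ₀
  hN := I.hN
  hT := I.hT
  hST := I.hST
  hODpot := I.hODpot

/-- ★★★★ **K1 `NearFlatRatioLaw` ⇐ the ANALYTIC rate input with potential on every `L ≥ 2` + lane A's SHELL** (`D L ≥ max 1 (|Site 3 L|/7)`, `M L ≥ 2`).
[cite: Luscher1983, §3] -/
theorem nearFlatRatioLaw_of_analyticRatePotInput (D M : ℕ → ℝ) (hD1 : ∀ L, 1 ≤ D L) (hD7 : ∀ (L : ℕ) [NeZero L], (Fintype.card (Site 3 L) : ℝ) ≤ 7 * D L) (hM : ∀ L, 2 ≤ M L)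
    (I : ∀ (L : ℕ) [NeZero L], 2 ≤ L → AnalyticRatePotInput L (D L) (M L))
    (hshell : ∀ (L : ℕ) [NeZero L], 2 ≤ L → InnerShellGainAt L (powScale (1 / 6)) (powScale (1 / 40))) :
    Summit.QuantumFields.YangMills.Theses.FlatTubeReduction.NearFlatRatioLaw :=
  nearFlatRatioLaw_of_recordRatePotInput (fun L => 42 * D L + 1) M (fun L => by linarith [hD1 L]) hM
    (fun L _ hL => (I L hL).toRecord (hD1 L) (hD7 L) (by linarith [hM L])) hshell

end Summit.QuantumFields.YangMills.Theorems.FemtoTransferGap.RateTube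

end
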